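import Mathlib.Topology.Algebra.Category.ProfiniteGrp.Completion
import Mathlib.Topology.Instances.AddCircle.Defs
import Mathlib.Data.ZMod.QuotientGroup
import Mathlib.GroupTheory.Archimedean
import Literature.AnabelianGeometry.AbsoluteAnabelian.MonoidKummerMapsSub
import HarnessLib

/-!
# `End(ℚ/ℤ) ≅ Ẑ` — the «`Hom(ℚ/ℤ, −)`» step of [AbsTopIII] Proposition 3.2 (i), made canonical

S. Mochizuki, *Topics in absolute anabelian geometry III*, Prop. 3.2 (i) p. 71 l.57–60: «… by applying
the functor `Hom(ℚ/ℤ, −)` to the resulting isomorphism `H²(G, μ_{ℚ/ℤ}(M_TM)) ⥲ ℚ/ℤ`» one obtains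
«the natural isomorphism `H²(G, μ_Ẑ(M_TM)) ⥲ Ẑ`»; the identification `End(ℚ/ℤ) ≅ Ẑ` used there (and in
Cor. 1.10 (a) «`μ_Ẑ(G_k) := Hom(ℚ/ℤ, μ_{ℚ/ℤ}(G_k))`») is the slot `Prop32iChain.endQmodZ` of
`MonoidKummerMapsSub.lean` (plan row P32.i.L06, abc-iut-w4-d045), so far a FREE datum. This file
CONSTRUCTS it for the tree's `Ẑ` = Mathlib's profinite completion of `ℤ` (`SemiGraphs.ZHat`, behind
`ZhatAdd`) and `ℚ/ℤ = AddCircle (1 : ℚ)` (behind `QmodZ`): `ZHatCompletion.toEnd z` = `u ↦ z • u` (`z`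
acts on an element of order `n` through `ℤ/nℤ`; `toEnd (η k) = k • id`, `toEnd (z z') = toEnd z +
toEnd z'`); `ZHatCompletion.ofEnd φ` = the element of `Ẑ` whose `ℤ/nℤ`-coordinate is the scalar by
which `φ` acts on the cyclic `n`-torsion `(1/n)ℤ/ℤ`; `ZHatCompletion.endAddCircleEquiv :
(ℚ/ℤ →+ ℚ/ℤ) ≃+ Additive Ẑ` (the two are inverse) and its universe-lifted form
`Prop32iChain.endQmodZCanonical : (QmodZ →+ QmodZ) ≃+ ZhatAdd` fitting the slot (instantiate
`endQmodZ := Prop32iChain.endQmodZCanonical`). Elementary (finite-index subgroups of `ℤ` are the `nℤ`;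
the `n`-torsion of `ℚ/ℤ` is cyclic of order `n`). HONEST FRAMING: classical; it replaces one abstract
slot of the printed chain of Prop. 3.2 (i) by its construction and discharges nothing else; nothing
here bears on [IUTchIII] Cor. 3.12; no side taken.
-/

noncomputable section

open CategoryTheory ProfiniteGrp ProfiniteGrp.ProfiniteCompletion
open Literature.AnabelianGeometry.SemiGraphs (ZHat)

namespace Literature.AnabelianGeometry.AbsoluteAnabelian

universe u

namespace ZHatCompletion

/-- Membership in a finite-index subgroup of `ℤ` is divisibility by its index (`H = [ℤ:H]·ℤ`).
[cite: MochizukiAbsTopIII2015, Proposition 3.2 (i) p.71] -/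
theorem ofAdd_mem_iff_index_dvd (H : Subgroup (Multiplicative ℤ)) [H.FiniteIndex] (x : ℤ) :
    Multiplicative.ofAdd x ∈ H ↔ (H.index : ℤ) ∣ x := by
  obtain ⟨A, rfl⟩ : ∃ A : AddSubgroup ℤ, H = AddSubgroup.toSubgroup A :=
    ⟨AddSubgroup.toSubgroup.symm H, (OrderIso.apply_symm_apply _ H).symm⟩
  obtain ⟨a, ha⟩ := Int.subgroup_cyclic A
  rw [← AddSubgroup.zmultiples_eq_closure] at ha
  subst ha
  have hmem : Multiplicative.ofAdd x ∈ AddSubgroup.toSubgroup (AddSubgroup.zmultiples a) ↔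
      x ∈ AddSubgroup.zmultiples a := Iff.rfl
  rw [hmem, AddSubgroup.index_toSubgroup, Int.index_zmultiples, Int.mem_zmultiples_iff, Int.natAbs_dvd]

/-- Two integers have the same class modulo a finite-index (normal) subgroup `N` of `ℤ` iff their
difference is divisible by `[ℤ:N]`. [cite: MochizukiAbsTopIII2015, Proposition 3.2 (i) p.71] -/
theorem mk_ofAdd_eq_mk_ofAdd_iff (N : FiniteIndexNormalSubgroup (Multiplicative ℤ)) (x y : ℤ) :
    (QuotientGroup.mk (Multiplicative.ofAdd x) : Multiplicative ℤ ⧸ N.toSubgroup) =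
        QuotientGroup.mk (Multiplicative.ofAdd y) ↔
      (N.toSubgroup.index : ℤ) ∣ x - y := by
  rw [QuotientGroup.eq, ← ofAdd_neg, ← ofAdd_add, ofAdd_mem_iff_index_dvd, neg_add_eq_sub,
    dvd_sub_comm]

/-- An integer representative of the `N`-coordinate of `z ∈ Ẑ`. [cite: MochizukiAbsTopIII2015, Proposition 3.2 (i) p.71] -/
def rep (N : FiniteIndexNormalSubgroup (Multiplicative ℤ)) (z : ZHat) : ℤ :=
  Multiplicative.toAdd (Quotient.out (z.val N) : Multiplicative ℤ)

/-- The `N`-coordinate of `z` is the class of `rep N z`. [cite: MochizukiAbsTopIII2015, Proposition 3.2 (i) p.71] -/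
theorem val_eq_mk_rep (N : FiniteIndexNormalSubgroup (Multiplicative ℤ)) (z : ZHat) :
    z.val N = (QuotientGroup.mk (Multiplicative.ofAdd (rep N z)) : Multiplicative ℤ ⧸ N.toSubgroup) := by
  rw [rep, ofAdd_toAdd]
  exact (QuotientGroup.out_eq' _).symm

/-- Compatibility of coordinates: for `N ≤ M` the representatives agree modulo `[ℤ:M]`.
[cite: MochizukiAbsTopIII2015, Proposition 3.2 (i) p.71] -/
theorem index_dvd_rep_sub_rep {N M : FiniteIndexNormalSubgroup (Multiplicative ℤ)} (h : N ≤ M)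
    (z : ZHat) : (M.toSubgroup.index : ℤ) ∣ rep N z - rep M z := by
  have hz : (diagram (GrpCat.of (Multiplicative ℤ))).map (homOfLE h) (z.val N) = z.val M :=
    z.2 (homOfLE h)
  have hN : (diagram (GrpCat.of (Multiplicative ℤ))).map (homOfLE h) (z.val N) =
      (QuotientGroup.mk (Multiplicative.ofAdd (rep N z)) : Multiplicative ℤ ⧸ M.toSubgroup) := by
    rw [val_eq_mk_rep N z]
    rfl
  rw [hN, val_eq_mk_rep M z] at hz
  exact (mk_ofAdd_eq_mk_ofAdd_iff M _ _).1 hz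

/-- `nℤ ⊆ ℤ` (`n ≠ 0`) as a finite-index normal subgroup of `Multiplicative ℤ`.
[cite: MochizukiAbsTopIII2015, Proposition 3.2 (i) p.71] -/
def level (n : ℕ) [NeZero n] : FiniteIndexNormalSubgroup (Multiplicative ℤ) :=
  letI : (AddSubgroup.toSubgroup (AddSubgroup.zmultiples (n : ℤ))).FiniteIndex :=
    ⟨by rw [AddSubgroup.index_toSubgroup, Int.index_zmultiples, Int.natAbs_natCast]; exact NeZero.ne n⟩
  FiniteIndexNormalSubgroup.ofSubgroup (AddSubgroup.toSubgroup (AddSubgroup.zmultiples (n : ℤ)))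

/-- `[ℤ : nℤ] = n`. [cite: MochizukiAbsTopIII2015, Proposition 3.2 (i) p.71] -/
theorem index_level (n : ℕ) [NeZero n] : (level n).toSubgroup.index = n := by
  change (AddSubgroup.toSubgroup (AddSubgroup.zmultiples (n : ℤ))).index = n
  rw [AddSubgroup.index_toSubgroup, Int.index_zmultiples, Int.natAbs_natCast]

/-- Membership in `level n` is divisibility by `n`. [cite: MochizukiAbsTopIII2015, Proposition 3.2 (i) p.71] -/
theorem ofAdd_mem_level_iff (n : ℕ) [NeZero n] (x : ℤ) :
    Multiplicative.ofAdd x ∈ level n ↔ (n : ℤ) ∣ x := by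
  rw [← FiniteIndexNormalSubgroup.mem_toSubgroup_iff, ofAdd_mem_iff_index_dvd, index_level]

/-- `m ∣ n ⇒ nℤ ⊆ mℤ`. [cite: MochizukiAbsTopIII2015, Proposition 3.2 (i) p.71] -/
theorem level_le_level {m n : ℕ} [NeZero m] [NeZero n] (h : m ∣ n) : level n ≤ level m := by
  intro x hx
  have hx' : Multiplicative.ofAdd (Multiplicative.toAdd x) ∈ level n := by rwa [ofAdd_toAdd]
  rw [ofAdd_mem_level_iff] at hx'
  have : Multiplicative.ofAdd (Multiplicative.toAdd x) ∈ level m :=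
    (ofAdd_mem_level_iff m _).2 ((Int.natCast_dvd_natCast.2 h).trans hx')
  rwa [ofAdd_toAdd] at this

/-- Every finite-index normal subgroup of `ℤ` IS the level of its index.
[cite: MochizukiAbsTopIII2015, Proposition 3.2 (i) p.71] -/
theorem le_level_index (N : FiniteIndexNormalSubgroup (Multiplicative ℤ))
    [NeZero N.toSubgroup.index] : N ≤ level N.toSubgroup.index := by
  intro x hx
  have hx' : Multiplicative.ofAdd (Multiplicative.toAdd x) ∈ N.toSubgroup := by
    rwa [ofAdd_toAdd]
  rw [ofAdd_mem_iff_index_dvd] at hx'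
  have : Multiplicative.ofAdd (Multiplicative.toAdd x) ∈ level N.toSubgroup.index :=
    (ofAdd_mem_level_iff _ _).2 hx'
  rwa [ofAdd_toAdd] at this

/-- The mod-`n` coordinate of `z ∈ Ẑ`, as an integer representative.
[cite: MochizukiAbsTopIII2015, Proposition 3.2 (i) p.71] -/
def repn (n : ℕ) [NeZero n] (z : ZHat) : ℤ := rep (level n) z

/-- Compatibility `repn n z ≡ repn m z (mod m)` for `m ∣ n`. [cite: MochizukiAbsTopIII2015, Proposition 3.2 (i) p.71] -/
theorem dvd_repn_sub_repn {m n : ℕ} [NeZero m] [NeZero n] (h : m ∣ n)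
    (z : ZHat) : (m : ℤ) ∣ repn n z - repn m z := by
  have := index_dvd_rep_sub_rep (level_le_level h) z
  rwa [index_level] at this

/-- `repn n` is additive modulo `n` (the group law of `Ẑ` is written multiplicatively).
[cite: MochizukiAbsTopIII2015, Proposition 3.2 (i) p.71] -/
theorem dvd_repn_mul (n : ℕ) [NeZero n] (z z' : ZHat) :
    (n : ℤ) ∣ repn n (z * z') - (repn n z + repn n z') := by
  have h : (QuotientGroup.mk (Multiplicative.ofAdd (rep (level n) (z * z'))) :
        Multiplicative ℤ ⧸ (level n).toSubgroup) =
      QuotientGroup.mk (Multiplicative.ofAdd (rep (level n) z)) *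
        QuotientGroup.mk (Multiplicative.ofAdd (rep (level n) z')) := by
    rw [← val_eq_mk_rep (level n) (z * z'), ← val_eq_mk_rep (level n) z, ← val_eq_mk_rep (level n) z']
    rfl
  rw [← QuotientGroup.mk_mul, ← ofAdd_add] at h
  have := (mk_ofAdd_eq_mk_ofAdd_iff _ _ _).1 h
  rwa [index_level] at this

/-- The coordinates of `η(k)`, `k ∈ ℤ`, are `≡ k`. [cite: MochizukiAbsTopIII2015, Proposition 3.2 (i) p.71] -/
theorem dvd_repn_etaFn_sub (n : ℕ) [NeZero n] (k : ℤ) :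
    (n : ℤ) ∣ repn n (etaFn (GrpCat.of (Multiplicative ℤ)) (Multiplicative.ofAdd k)) - k := by
  have h : (etaFn (GrpCat.of (Multiplicative ℤ)) (Multiplicative.ofAdd k)).val (level n) =
      (QuotientGroup.mk (Multiplicative.ofAdd k) : Multiplicative ℤ ⧸ (level n).toSubgroup) := rfl
  rw [val_eq_mk_rep] at h
  have := (mk_ofAdd_eq_mk_ofAdd_iff _ _ _).1 h
  rwa [index_level] at this

/-- Every element of `ℚ/ℤ` has finite (positive) order. [cite: MochizukiAbsTopIII2015, Proposition 3.2 (i) p.71] -/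
theorem addOrderOf_pos_addCircle (u : AddCircle (1 : ℚ)) : 0 < addOrderOf u := by
  induction u using QuotientAddGroup.induction_on with
  | H q =>
    have h := AddCircle.addOrderOf_coe_rat (p := (1 : ℚ)) (q := q)
    rw [Rat.cast_id, mul_one] at h
    change 0 < addOrderOf ((q : ℚ) : AddCircle (1 : ℚ))
    rw [h]
    exact q.pos

/-- In `ℚ/ℤ`: if `m • u = 0` and `m ∣ a - b` then `a • u = b • u`. [cite: MochizukiAbsTopIII2015, Proposition 3.2 (i) p.71] -/
theorem zsmul_eq_zsmul_of_dvd_sub {A : Type*} [AddCommGroup A] {u : A} {m : ℕ} (hu : m • u = 0)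
    {a b : ℤ} (h : (m : ℤ) ∣ a - b) : a • u = b • u := by
  obtain ⟨c, hc⟩ := h
  have ha : a = b + c * m := by rw [mul_comm, ← hc]; ring
  rw [ha, add_zsmul, ← smul_smul, natCast_zsmul, hu, zsmul_zero, add_zero]

/-- The `n`-torsion of `ℚ/ℤ` consists of the multiples of `1/n`. [cite: MochizukiAbsTopIII2015, Proposition 3.2 (i) p.71] -/
theorem exists_eq_nsmul_inv_of_nsmul_eq_zero {n : ℕ} (hn : 0 < n) {u : AddCircle (1 : ℚ)}
    (hu : n • u = 0) : ∃ m : ℕ, u = m • (((1 : ℚ) / n : ℚ) : AddCircle (1 : ℚ)) := by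
  obtain ⟨m, -, hm⟩ := (AddCircle.nsmul_eq_zero_iff hn).1 hu
  refine ⟨m, ?_⟩
  rw [← hm, AddCircle.natCast_div_mul_eq_nsmul]

/-- `n • (1/n) = 0` in `ℚ/ℤ`. [cite: MochizukiAbsTopIII2015, Proposition 3.2 (i) p.71] -/
theorem nsmul_inv_eq_zero (n : ℕ) [NeZero n] : n • (((1 : ℚ) / n : ℚ) : AddCircle (1 : ℚ)) = 0 := by
  rw [← addOrderOf_dvd_iff_nsmul_eq_zero, AddCircle.addOrderOf_period_div (NeZero.pos n)]

/-- `z • u` for `z ∈ Ẑ`, `u ∈ ℚ/ℤ`: act through the mod-`n` coordinate, `n` the order of `u`.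
[cite: MochizukiAbsTopIII2015, Proposition 3.2 (i) p.71] -/
def smulFun (z : ZHat) (u : AddCircle (1 : ℚ)) : AddCircle (1 : ℚ) :=
  haveI : NeZero (addOrderOf u) := ⟨(addOrderOf_pos_addCircle u).ne'⟩
  repn (addOrderOf u) z • u

/-- `z • u` may be computed through ANY level `n` killing `u`. [cite: MochizukiAbsTopIII2015, Proposition 3.2 (i) p.71] -/
theorem smulFun_eq_repn_zsmul (z : ZHat) {u : AddCircle (1 : ℚ)}
    {n : ℕ} [NeZero n] (hu : n • u = 0) : smulFun z u = repn n z • u := by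
  haveI : NeZero (addOrderOf u) := ⟨(addOrderOf_pos_addCircle u).ne'⟩
  have hdvd : addOrderOf u ∣ n := addOrderOf_dvd_of_nsmul_eq_zero hu
  change repn (addOrderOf u) z • u = repn n z • u
  exact (zsmul_eq_zsmul_of_dvd_sub (addOrderOf_nsmul_eq_zero u) (dvd_repn_sub_repn hdvd z)).symm

/-- `z • (u + v) = z • u + z • v`. [cite: MochizukiAbsTopIII2015, Proposition 3.2 (i) p.71] -/
theorem smulFun_add (z : ZHat) (u v : AddCircle (1 : ℚ)) :
    smulFun z (u + v) = smulFun z u + smulFun z v := by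
  haveI : NeZero (addOrderOf u * addOrderOf v) :=
    ⟨Nat.mul_ne_zero (addOrderOf_pos_addCircle u).ne' (addOrderOf_pos_addCircle v).ne'⟩
  have hu : (addOrderOf u * addOrderOf v) • u = 0 := by
    rw [mul_nsmul, addOrderOf_nsmul_eq_zero, nsmul_zero]
  have hv : (addOrderOf u * addOrderOf v) • v = 0 := by
    rw [mul_comm, mul_nsmul, addOrderOf_nsmul_eq_zero, nsmul_zero]
  have huv : (addOrderOf u * addOrderOf v) • (u + v) = 0 := by rw [nsmul_add, hu, hv, add_zero]
  rw [smulFun_eq_repn_zsmul z huv, smulFun_eq_repn_zsmul z hu, smulFun_eq_repn_zsmul z hv, zsmul_add]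

/-- `(z z') • u = z • u + z' • u`. [cite: MochizukiAbsTopIII2015, Proposition 3.2 (i) p.71] -/
theorem smulFun_mul (z z' : ZHat) (u : AddCircle (1 : ℚ)) :
    smulFun (z * z') u = smulFun z u + smulFun z' u := by
  haveI : NeZero (addOrderOf u) := ⟨(addOrderOf_pos_addCircle u).ne'⟩
  have hu : addOrderOf u • u = 0 := addOrderOf_nsmul_eq_zero u
  rw [smulFun_eq_repn_zsmul _ hu, smulFun_eq_repn_zsmul _ hu, smulFun_eq_repn_zsmul _ hu, ← add_zsmul]
  exact zsmul_eq_zsmul_of_dvd_sub hu (dvd_repn_mul _ z z')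

/-- **`Ẑ → End(ℚ/ℤ)`**: the endomorphism `u ↦ z • u`. [cite: MochizukiAbsTopIII2015, Proposition 3.2 (i) p.71] -/
def toEnd (z : ZHat) : AddCircle (1 : ℚ) →+ AddCircle (1 : ℚ) where
  toFun := smulFun z
  map_zero' := by
    haveI : NeZero (1 : ℕ) := inferInstance
    rw [smulFun_eq_repn_zsmul z (show (1 : ℕ) • (0 : AddCircle (1 : ℚ)) = 0 from nsmul_zero _),
      zsmul_zero]
  map_add' := smulFun_add z

/-- `toEnd z u = repn n z • u` whenever `n • u = 0`. [cite: MochizukiAbsTopIII2015, Proposition 3.2 (i) p.71] -/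
theorem toEnd_apply_eq (z : ZHat) {u : AddCircle (1 : ℚ)} {n : ℕ}
    [NeZero n] (hu : n • u = 0) : toEnd z u = repn n z • u :=
  smulFun_eq_repn_zsmul z hu

/-- `toEnd` turns the (multiplicatively written) group law of `Ẑ` into addition of endomorphisms.
[cite: MochizukiAbsTopIII2015, Proposition 3.2 (i) p.71] -/
theorem toEnd_mul (z z' : ZHat) : toEnd (z * z') = toEnd z + toEnd z' :=
  AddMonoidHom.ext fun u => smulFun_mul z z' u

/-- **Normalisation**: the integer `k ∈ ℤ ⊆ Ẑ` acts as multiplication by `k`.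
[cite: MochizukiAbsTopIII2015, Proposition 3.2 (i) p.71] -/
theorem toEnd_etaFn (k : ℤ) (u : AddCircle (1 : ℚ)) :
    toEnd (etaFn (GrpCat.of (Multiplicative ℤ)) (Multiplicative.ofAdd k)) u = k • u := by
  haveI : NeZero (addOrderOf u) := ⟨(addOrderOf_pos_addCircle u).ne'⟩
  have hu : addOrderOf u • u = 0 := addOrderOf_nsmul_eq_zero u
  rw [toEnd_apply_eq _ hu]
  exact zsmul_eq_zsmul_of_dvd_sub hu (dvd_repn_etaFn_sub _ k)

/-- An endomorphism of `ℚ/ℤ` acts on `1/n` by an integer scalar (the `n`-torsion is cyclic).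
[cite: MochizukiAbsTopIII2015, Proposition 3.2 (i) p.71] -/
theorem exists_apply_inv_eq_zsmul (φ : AddCircle (1 : ℚ) →+ AddCircle (1 : ℚ)) {n : ℕ} (hn : 0 < n) :
    ∃ k : ℤ, φ ((((1 : ℚ) / n : ℚ) : AddCircle (1 : ℚ))) = k • (((1 : ℚ) / n : ℚ) : AddCircle (1 : ℚ)) := by
  haveI : NeZero n := ⟨hn.ne'⟩
  have h : n • φ ((((1 : ℚ) / n : ℚ) : AddCircle (1 : ℚ))) = 0 := by
    rw [← map_nsmul, nsmul_inv_eq_zero, map_zero]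
  obtain ⟨m, hm⟩ := exists_eq_nsmul_inv_of_nsmul_eq_zero hn h
  exact ⟨m, by rw [hm, natCast_zsmul]⟩

/-- The `n`-th coefficient of `φ ∈ End(ℚ/ℤ)`: `φ(1/n) = coeff φ n • (1/n)` (`0` for `n = 0`).
[cite: MochizukiAbsTopIII2015, Proposition 3.2 (i) p.71] -/
def coeff (φ : AddCircle (1 : ℚ) →+ AddCircle (1 : ℚ)) (n : ℕ) : ℤ :=
  if hn : 0 < n then (exists_apply_inv_eq_zsmul φ hn).choose else 0

/-- Defining property of `coeff`. [cite: MochizukiAbsTopIII2015, Proposition 3.2 (i) p.71] -/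
theorem apply_inv_eq_coeff_zsmul (φ : AddCircle (1 : ℚ) →+ AddCircle (1 : ℚ)) {n : ℕ} (hn : 0 < n) :
    φ ((((1 : ℚ) / n : ℚ) : AddCircle (1 : ℚ))) = coeff φ n • (((1 : ℚ) / n : ℚ) : AddCircle (1 : ℚ)) := by
  rw [coeff, dif_pos hn]
  exact (exists_apply_inv_eq_zsmul φ hn).choose_spec

/-- `φ` acts on the whole `n`-torsion by the scalar `coeff φ n`. [cite: MochizukiAbsTopIII2015, Proposition 3.2 (i) p.71] -/
theorem apply_eq_coeff_zsmul (φ : AddCircle (1 : ℚ) →+ AddCircle (1 : ℚ)) {n : ℕ} (hn : 0 < n)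
    {u : AddCircle (1 : ℚ)} (hu : n • u = 0) : φ u = coeff φ n • u := by
  obtain ⟨m, rfl⟩ := exists_eq_nsmul_inv_of_nsmul_eq_zero hn hu
  rw [map_nsmul, apply_inv_eq_coeff_zsmul φ hn, smul_comm]

/-- Compatibility of the coefficients: `m ∣ n ⇒ coeff φ n ≡ coeff φ m (mod m)`.
[cite: MochizukiAbsTopIII2015, Proposition 3.2 (i) p.71] -/
theorem dvd_coeff_sub_coeff (φ : AddCircle (1 : ℚ) →+ AddCircle (1 : ℚ)) {m n : ℕ} (hm : 0 < m)
    (hn : 0 < n) (h : m ∣ n) : (m : ℤ) ∣ coeff φ n - coeff φ m := by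
  haveI : NeZero m := ⟨hm.ne'⟩
  set w : AddCircle (1 : ℚ) := (((1 : ℚ) / m : ℚ) : AddCircle (1 : ℚ)) with hw
  have hwm : m • w = 0 := nsmul_inv_eq_zero m
  have hwn : n • w = 0 := by
    obtain ⟨c, rfl⟩ := h
    rw [mul_nsmul, hwm, nsmul_zero]
  have h1 := apply_eq_coeff_zsmul φ hn hwn
  rw [apply_inv_eq_coeff_zsmul φ hm, ← sub_eq_zero, ← sub_smul] at h1
  have h2 : (addOrderOf w : ℤ) ∣ coeff φ m - coeff φ n := (addOrderOf_dvd_iff_zsmul_eq_zero).2 h1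
  rw [hw, AddCircle.addOrderOf_period_div hm] at h2
  exact (dvd_sub_comm.1 h2)

/-- **`End(ℚ/ℤ) → Ẑ`**: the element of `Ẑ` whose `ℤ/N`-coordinate is `coeff φ [ℤ:N]`.
[cite: MochizukiAbsTopIII2015, Proposition 3.2 (i) p.71] -/
def ofEnd (φ : AddCircle (1 : ℚ) →+ AddCircle (1 : ℚ)) : ZHat :=
  ⟨fun N => QuotientGroup.mk (Multiplicative.ofAdd (coeff φ N.toSubgroup.index)), fun N M π => by
    change (QuotientGroup.mk (Multiplicative.ofAdd (coeff φ N.toSubgroup.index)) :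
        Multiplicative ℤ ⧸ M.toSubgroup) =
      QuotientGroup.mk (Multiplicative.ofAdd (coeff φ M.toSubgroup.index))
    rw [mk_ofAdd_eq_mk_ofAdd_iff]
    exact dvd_coeff_sub_coeff φ (Nat.pos_of_ne_zero Subgroup.FiniteIndex.index_ne_zero)
      (Nat.pos_of_ne_zero Subgroup.FiniteIndex.index_ne_zero) (Subgroup.index_dvd_of_le π.le)⟩

/-- The coordinates of `ofEnd φ`. [cite: MochizukiAbsTopIII2015, Proposition 3.2 (i) p.71] -/
theorem val_ofEnd (φ : AddCircle (1 : ℚ) →+ AddCircle (1 : ℚ)) (N : FiniteIndexNormalSubgroup (Multiplicative ℤ)) :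
    (ofEnd φ).val N =
      (QuotientGroup.mk (Multiplicative.ofAdd (coeff φ N.toSubgroup.index)) : Multiplicative ℤ ⧸ N.toSubgroup) :=
  rfl

/-- `repn n (ofEnd φ) ≡ coeff φ n (mod n)`. [cite: MochizukiAbsTopIII2015, Proposition 3.2 (i) p.71] -/
theorem dvd_repn_ofEnd_sub_coeff (φ : AddCircle (1 : ℚ) →+ AddCircle (1 : ℚ)) (n : ℕ) [NeZero n] :
    (n : ℤ) ∣ repn n (ofEnd φ) - coeff φ n := by
  have h := val_ofEnd φ (level n)
  rw [val_eq_mk_rep, index_level] at h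
  have := (mk_ofAdd_eq_mk_ofAdd_iff _ _ _).1 h
  rwa [index_level] at this

/-- **`toEnd ∘ ofEnd = id`**. [cite: MochizukiAbsTopIII2015, Proposition 3.2 (i) p.71] -/
theorem toEnd_ofEnd (φ : AddCircle (1 : ℚ) →+ AddCircle (1 : ℚ)) : toEnd (ofEnd φ) = φ := by
  refine AddMonoidHom.ext fun u => ?_
  haveI : NeZero (addOrderOf u) := ⟨(addOrderOf_pos_addCircle u).ne'⟩
  have hu : addOrderOf u • u = 0 := addOrderOf_nsmul_eq_zero u
  rw [toEnd_apply_eq _ hu, apply_eq_coeff_zsmul φ (addOrderOf_pos_addCircle u) hu]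
  exact zsmul_eq_zsmul_of_dvd_sub hu (dvd_repn_ofEnd_sub_coeff φ _)

/-- **`ofEnd ∘ toEnd = id`**. [cite: MochizukiAbsTopIII2015, Proposition 3.2 (i) p.71] -/
theorem ofEnd_toEnd (z : ZHat) : ofEnd (toEnd z) = z := by
  apply ProfiniteGrp.limit_ext
  intro N
  haveI : NeZero N.toSubgroup.index := ⟨Subgroup.FiniteIndex.index_ne_zero⟩
  rw [val_ofEnd, val_eq_mk_rep N z]
  refine (mk_ofAdd_eq_mk_ofAdd_iff N _ _).2 ?_
  set d := N.toSubgroup.index with hd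
  -- `coeff (toEnd z) d ≡ repn d z (mod d)`: compare the two actions on `1/d`
  have hw : d • (((1 : ℚ) / d : ℚ) : AddCircle (1 : ℚ)) = 0 := nsmul_inv_eq_zero d
  have h1 := apply_inv_eq_coeff_zsmul (toEnd z) (NeZero.pos d)
  rw [toEnd_apply_eq z hw, ← sub_eq_zero, ← sub_smul] at h1
  have h2 : (addOrderOf (((1 : ℚ) / d : ℚ) : AddCircle (1 : ℚ)) : ℤ) ∣ repn d z - coeff (toEnd z) d :=
    (addOrderOf_dvd_iff_zsmul_eq_zero).2 h1
  rw [AddCircle.addOrderOf_period_div (NeZero.pos d)] at h2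
  -- `repn d z ≡ rep N z (mod d)`: `N` is the level of its index
  have h3 : ((level d).toSubgroup.index : ℤ) ∣ rep N z - rep (level d) z :=
    index_dvd_rep_sub_rep (le_level_index N) z
  rw [index_level] at h3
  have h4 : (d : ℤ) ∣ coeff (toEnd z) d - repn d z := dvd_sub_comm.1 h2
  have := h4.add (dvd_sub_comm.1 h3)
  rwa [repn, sub_add_sub_cancel] at this

/-- **`End(ℚ/ℤ) ≅ Ẑ`** (additive groups; `Ẑ` = Mathlib's profinite completion of `ℤ`), normalised by
`k • id ↦ η(k)` (`toEnd_etaFn`): the identification «`Hom(ℚ/ℤ, ℚ/ℤ) = Ẑ`» behind «applying the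
functor `Hom(ℚ/ℤ, −)`» in Prop. 3.2 (i). CONSTRUCTED. [cite: MochizukiAbsTopIII2015, Proposition 3.2 (i) p.71] -/
def endAddCircleEquiv : (AddCircle (1 : ℚ) →+ AddCircle (1 : ℚ)) ≃+ Additive ZHat where
  toFun φ := Additive.ofMul (ofEnd φ)
  invFun z := toEnd (Additive.toMul z)
  left_inv φ := toEnd_ofEnd φ
  right_inv z := congrArg Additive.ofMul (ofEnd_toEnd (Additive.toMul z))
  map_add' φ ψ := by
    change Additive.ofMul (ofEnd (φ + ψ)) = Additive.ofMul (ofEnd φ * ofEnd ψ)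
    congr 1
    apply Function.LeftInverse.injective ofEnd_toEnd
    rw [toEnd_mul, toEnd_ofEnd, toEnd_ofEnd, toEnd_ofEnd]

/-- `endAddCircleEquiv` on `k • id` is `η(k)`. [cite: MochizukiAbsTopIII2015, Proposition 3.2 (i) p.71] -/
theorem endAddCircleEquiv_zsmul_id (k : ℤ) :
    endAddCircleEquiv (k • AddMonoidHom.id (AddCircle (1 : ℚ))) =
      Additive.ofMul (etaFn (GrpCat.of (Multiplicative ℤ)) (Multiplicative.ofAdd k)) := by
  change Additive.ofMul (ofEnd _) = _
  congr 1
  apply Function.LeftInverse.injective ofEnd_toEnd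
  rw [toEnd_ofEnd]
  refine AddMonoidHom.ext fun u => ?_
  rw [toEnd_etaFn, AddMonoidHom.zsmul_apply, AddMonoidHom.id_apply]

end ZHatCompletion

/-- **Row P32.i.L06, second half, CONSTRUCTED**: the canonical `Hom(ℚ/ℤ, ℚ/ℤ) ≃+ Ẑ` in the types of
the slot `Prop32iChain.endQmodZ : (QmodZ →+ QmodZ) ≃+ ZhatAdd` (both sides `ULift`ed). Any
`Prop32iChain` may (and the model instance should) take `endQmodZ := Prop32iChain.endQmodZCanonical`.
[cite: MochizukiAbsTopIII2015, Proposition 3.2 (i) p.71] -/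
def Prop32iChain.endQmodZCanonical : (QmodZ.{u} →+ QmodZ.{u}) ≃+ ZhatAdd.{u} :=
  ((AddEquiv.ulift.addMonoidHomCongrLeft).trans (AddEquiv.ulift.addMonoidHomCongrRight)).trans
    (ZHatCompletion.endAddCircleEquiv.trans AddEquiv.ulift.symm)

/-- Normalisation of `endQmodZCanonical`: `k • id ↦ η(k)`. [cite: MochizukiAbsTopIII2015, Proposition 3.2 (i) p.71] -/
theorem Prop32iChain.endQmodZCanonical_zsmul_id (k : ℤ) :
    Prop32iChain.endQmodZCanonical.{u} (k • AddMonoidHom.id QmodZ.{u}) =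
      ULift.up (Additive.ofMul (etaFn (GrpCat.of (Multiplicative ℤ)) (Multiplicative.ofAdd k))) := by
  have h : (AddEquiv.ulift.addMonoidHomCongrLeft.trans AddEquiv.ulift.addMonoidHomCongrRight)
      (k • AddMonoidHom.id QmodZ.{u}) = k • AddMonoidHom.id (AddCircle (1 : ℚ)) :=
    AddMonoidHom.ext fun _ => rfl
  change AddEquiv.ulift.symm (ZHatCompletion.endAddCircleEquiv
    ((AddEquiv.ulift.addMonoidHomCongrLeft.trans AddEquiv.ulift.addMonoidHomCongrRight)
      (k • AddMonoidHom.id QmodZ.{u}))) = _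
  rw [h, ZHatCompletion.endAddCircleEquiv_zsmul_id]
  rfl

end Literature.AnabelianGeometry.AbsoluteAnabelian

end
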